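import Literature.AnabelianGeometry.SemiGraphs.CoveringGraphIncidenceDictionary
import Literature.AnabelianGeometry.SemiGraphs.TemperedEdgeLikeHostThroughBranch
import Literature.AnabelianGeometry.SemiGraphs.CompactInVerticialAtCoveringGraphCorollaries
import HarnessLib

/-!
# [SemiAnbd] Example 3.10 / Def. 3.5 (i): the action of `Π = π₁^temp(𝒢)` on the FIBRES of a Galois covering
# semi-graph `𝒢_S` over the vertices and edges of `𝒢`, and its COMPATIBILITY WITH INCIDENCE

Mochizuki, *Semi-graphs of anabelioids*, Publ. RIMS **42** (2006), §3, Example 3.10, manuscript p. 44 l. 12–17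
[cite: MochizukiSemiAnbd2006, Ex 3.10 p.44] ("semi-graphs of anabelioids `𝒢_i` … on which `Δ_i` acts"), Def. 3.5 (i)
p. 37 (the covering `G_S → G`: vertices, edges, branches of `G_S` are orbits; a branch `(b, ω)` abuts to
`(v, glueOrbit ω)`), Thm. 3.7 (i)–(iii) pp. 40–41; [IUTchI] proof of Prop. 2.4 (i) p. 50 [cite: Mochizuki2012, Prop 2.4(i) p.50].

PROOF-ONLY brick (abc-iut cell, layer L3, seat abc-iut-L3-t2 gen 5, row «Ex310-GRAPH-ACTION», part H-a; no
definition, no instance, no new named fact).  Setting of `CoveringGraphVertexFibres.lean`: `G` Thm-3.7 and strictly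
coherent with Thm. 3.7 (iii) AT `G` (`CompactInVerticialAt G`, a theorem for finite `G`) and the commensurable
rigidity `hCT` of edge-like subgroups; a connected tempered `S` whose base-point stabiliser `U = Stab_Π(x₀)` is NORMAL
in `Π` (a Galois covering), a chart `c_S` of `G_S` with `φ : U ⥲ π₁^temp(G_S)` compatible with the explicit
equivalences.  `CovObj.exists_galois_fibreActions` delivers, fibre by fibre, homomorphisms
`σ_v : Π →* Perm(vertices of 𝔾_S over v)` and `τ_e : Π →* Perm(edges of 𝔾_S over e)` DERIVED from conjugation
(dictionary laws: the trace of `gKg⁻¹` is verticial at `σ_v(g)(ω)` when that of `K` is verticial at `ω`, idem for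
edges), transitive on every fibre, trivial on `U` — AND THE INCIDENCE LAW
`σ_v(g)(glueOrbit_b ω) = glueOrbit_b(τ_e(g)(ω))`: the actions on vertices and edges are the vertex and edge parts of
ONE action on the semi-graph `𝔾_S` (assembled in the companion `SpecialFibreTowerOfCoveringsGraphAction.lean`).
The incidence law is the new content: the INCIDENCE DICTIONARY (`CovObj.exists_branch_traces_of_abuts`: the branch
`(b, ω)` abuts to the vertex carrying the trace of the host THROUGH `b` of an edge-like subgroup traced at `(e, ω)`)
and the UNIQUENESS OF THE HOST THROUGH A BRANCH (`host_eq_of_presentations_through_branch'`).  Nothing here is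
about curves; no side is taken on [IUTchIII] Cor. 3.12.
-/

noncomputable section

open CategoryTheory Topology

namespace Literature.AnabelianGeometry.SemiGraphs

open Literature.AlgebraicGeometry.Frobenioids (IsConnectedObj)
open ProfiniteSemiGraph

universe u

/-! ### Helpers -/

/-- **A uniquely solvable, unital, composable specification defines a permutation action.** [folklore] -/
private theorem exists_perm_hom_of_existsUnique' {G : Type u} [Group G] {X : Type u} (spec : G → X → X → Prop)
    (hex : ∀ g x, ∃! w, spec g x w) (hone : ∀ x, spec 1 x x)
    (hmul : ∀ g h x y z, spec h x y → spec g y z → spec (g * h) x z) :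
    ∃ σ : G →* Equiv.Perm X, ∀ g x, spec g x (σ g x) := by
  classical
  let f : G → X → X := fun g x => (hex g x).exists.choose
  have hf : ∀ g x, spec g x (f g x) := fun g x => (hex g x).exists.choose_spec
  have hf1 : ∀ x, f 1 x = x := fun x => (hex 1 x).unique (hf 1 x) (hone x)
  have hfmul : ∀ g h x, f (g * h) x = f g (f h x) := fun g h x =>
    (hex (g * h) x).unique (hf (g * h) x) (hmul g h x _ _ (hf h x) (hf g (f h x)))
  let σ : G →* Equiv.Perm X :=
    { toFun := fun g =>
        { toFun := f g
          invFun := f g⁻¹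
          left_inv := fun x => by rw [← hfmul, inv_mul_cancel, hf1]
          right_inv := fun x => by rw [← hfmul, mul_inv_cancel, hf1] }
      map_one' := Equiv.ext fun x => hf1 x
      map_mul' := fun g h => Equiv.ext fun x => hfmul g h x }
  exact ⟨σ, fun g x => hf g x⟩

/-- `g (n K n⁻¹) g⁻¹ = (g n g⁻¹) (g K g⁻¹) (g n g⁻¹)⁻¹`. [folklore] -/
private theorem map_conj_conj_swap' {G : Type u} [Group G] (K : Subgroup G) (g n : G) :
    (K.map (MulAut.conj n).toMonoidHom).map (MulAut.conj g).toMonoidHom =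
      (K.map (MulAut.conj g).toMonoidHom).map (MulAut.conj (g * n * g⁻¹)).toMonoidHom := by
  simp only [Subgroup.map_map]; congr 1; ext x
  simp only [MonoidHom.coe_comp, MulEquiv.coe_toMonoidHom, Function.comp_apply, MulAut.conj_apply]; group

/-- `(g h) K (g h)⁻¹ = g (h K h⁻¹) g⁻¹`. [folklore] -/
private theorem map_conj_mul'' {G : Type u} [Group G] (K : Subgroup G) (g h : G) :
    K.map (MulAut.conj (g * h)).toMonoidHom = (K.map (MulAut.conj h).toMonoidHom).map (MulAut.conj g).toMonoidHom := by
  rw [map_mul, Subgroup.map_map]; rfl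

/-- `1 K 1⁻¹ = K`. [folklore] -/
private theorem map_conj_one'' {G : Type u} [Group G] (K : Subgroup G) :
    K.map (MulAut.conj (1 : G)).toMonoidHom = K := by
  rw [map_one]; exact K.map_id

/-- Conjugating a subgroup by one of its elements does not change it. [folklore] -/
private theorem map_conj_eq_self_of_mem'' {G : Type u} [Group G] {K : Subgroup G} {g : G} (hg : g ∈ K) :
    K.map (MulAut.conj g).toMonoidHom = K := by
  ext x
  constructor
  · rintro ⟨y, hy, rfl⟩
    exact K.mul_mem (K.mul_mem hg hy) (K.inv_mem hg)
  · intro hx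
    exact ⟨g⁻¹ * x * g, K.mul_mem (K.mul_mem (K.inv_mem hg) hx) hg, by
      simp only [MulEquiv.coe_toMonoidHom, MulAut.conj_apply]; group⟩

/-- If `y·ψ·y⁻¹ = φ` pointwise then `g·φ(A)·g⁻¹ = (g y)·ψ(A)·(g y)⁻¹`. [folklore] -/
private theorem map_map_conj_eq_of_conj_eq' {Γ Λ : Type u} [Group Γ] [Group Λ] [TopologicalSpace Γ]
    [TopologicalSpace Λ] (ψ φ : Γ →ₜ* Λ) (y : Λ) (hy : ∀ a, y * ψ a * y⁻¹ = φ a) (A : Subgroup Γ) (g : Λ) :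
    (A.map φ.toMonoidHom).map (MulAut.conj g).toMonoidHom =
      (A.map ψ.toMonoidHom).map (MulAut.conj (g * y)).toMonoidHom := by
  rw [Subgroup.map_map, Subgroup.map_map]
  congr 1
  ext a
  show g * φ a * g⁻¹ = g * y * ψ a * (g * y)⁻¹
  rw [← hy a, mul_inv_rev]
  group

namespace ProfiniteSemiGraph

namespace CovObj

variable {𝒢 : ProfiniteSemiGraph.{u}} (S : CovObj 𝒢)

/-- **[SemiAnbd] Ex. 3.10 / Def. 3.5 (i) — the action of `Π` on the fibres of a Galois `𝒢_S`, compatible with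
incidence.**  See the module docstring. [cite: MochizukiSemiAnbd2006, Ex 3.10 p.44] -/
theorem exists_galois_fibreActions (h37 : 𝒢.Thm37Hypotheses) (hsc : 𝒢.IsStrictlyCoherent)
    (hCV : CompactInVerticialAt 𝒢) (c : TemperedPiChart 𝒢)
    (hCT : ∀ (e : 𝒢.graph.Edge) (L L' : Subgroup c.G), L ∈ edgeLikeSubgroups c e → L' ∈ edgeLikeSubgroups c e →
      Subgroup.Commensurable L L' → L = L')
    (hS : S.IsTempered) (hSc : IsConnectedObj (⟨S, hS⟩ : BTempCat 𝒢)) (cS : TemperedPiChart S.coveringGraph)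
    (ω₀ : BTemp.Orbits (c.equiv.functor.obj ⟨S, hS⟩))
    (φ : BTemp.stab (c.equiv.functor.obj ⟨S, hS⟩) (Quot.out ω₀) →ₜ* cS.G)
    (hφ : Nonempty (cS.equiv.inverse ⋙
          (S.etaleEquiv uniformSplitting_holds h37.toProp36Hypotheses hsc.isCoherent hS).functor ⋙
          (Over.postEquiv (⟨S, hS⟩ : BTempCat 𝒢) c.equiv).functor ⋙
          BTemp.fibreFamily (c.equiv.functor.obj ⟨S, hS⟩) ⋙
          Pi.eval (fun ω => BTemp (BTemp.stab (c.equiv.functor.obj ⟨S, hS⟩) (Quot.out ω))) ω₀ ≅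
        BTemp.res φ))
    (hφb : Function.Bijective φ) (hU : (BTemp.stab (c.equiv.functor.obj ⟨S, hS⟩) (Quot.out ω₀)).Normal) :
    ∃ (σ : ∀ v : 𝒢.graph.Vertex, c.G →* Equiv.Perm (BTemp.Orbits (S.SV v)))
      (τ : ∀ e : 𝒢.graph.Edge, c.G →* Equiv.Perm (BTemp.Orbits (S.SE e))),
      -- vertices: dictionary law, transitivity, `U` acts trivially
      (∀ (g : c.G) (v : 𝒢.graph.Vertex) (ω : BTemp.Orbits (S.SV v)) (K : Subgroup c.G),
        K ∈ verticialSubgroups c v →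
        (K.subgroupOf (BTemp.stab (c.equiv.functor.obj ⟨S, hS⟩) (Quot.out ω₀))).map φ.toMonoidHom ∈
          verticialSubgroups cS (⟨v, ω⟩ : S.coveringGraph.graph.Vertex) →
        ((K.map (MulAut.conj g).toMonoidHom).subgroupOf
            (BTemp.stab (c.equiv.functor.obj ⟨S, hS⟩) (Quot.out ω₀))).map φ.toMonoidHom ∈
          verticialSubgroups cS (⟨v, σ v g ω⟩ : S.coveringGraph.graph.Vertex)) ∧
      (∀ (v : 𝒢.graph.Vertex) (ω₁ ω₂ : BTemp.Orbits (S.SV v)), ∃ g, σ v g ω₁ = ω₂) ∧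
      (∀ (v : 𝒢.graph.Vertex), ∀ n ∈ BTemp.stab (c.equiv.functor.obj ⟨S, hS⟩) (Quot.out ω₀), σ v n = 1) ∧
      -- edges: dictionary law, transitivity, `U` acts trivially
      (∀ (g : c.G) (e : 𝒢.graph.Edge) (ω : BTemp.Orbits (S.SE e)) (L : Subgroup c.G),
        L ∈ edgeLikeSubgroups c e →
        (L.subgroupOf (BTemp.stab (c.equiv.functor.obj ⟨S, hS⟩) (Quot.out ω₀))).map φ.toMonoidHom ∈
          edgeLikeSubgroups cS (⟨e, ω⟩ : S.coveringGraph.graph.Edge) →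
        ((L.map (MulAut.conj g).toMonoidHom).subgroupOf
            (BTemp.stab (c.equiv.functor.obj ⟨S, hS⟩) (Quot.out ω₀))).map φ.toMonoidHom ∈
          edgeLikeSubgroups cS (⟨e, τ e g ω⟩ : S.coveringGraph.graph.Edge)) ∧
      (∀ (e : 𝒢.graph.Edge) (ω₁ ω₂ : BTemp.Orbits (S.SE e)), ∃ g, τ e g ω₁ = ω₂) ∧
      (∀ (e : 𝒢.graph.Edge), ∀ n ∈ BTemp.stab (c.equiv.functor.obj ⟨S, hS⟩) (Quot.out ω₀), τ e n = 1) ∧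
      -- INCIDENCE: the vertex action carries the vertex a branch abuts to, to the vertex the moved branch abuts to
      (∀ (g : c.G) {b : 𝒢.graph.Branch} {v : 𝒢.graph.Vertex} (hb : 𝒢.graph.abuts b = some v)
        (ω : BTemp.Orbits (S.SE (𝒢.graph.edgeOf b))),
        σ v g (S.glueOrbit b v hb ω) = S.glueOrbit b v hb (τ (𝒢.graph.edgeOf b) g ω)) := by
  classical
  haveI := c.secondCountableTopology; haveI := c.isTopologicalGroup
  have h36 : 𝒢.Prop36Hypotheses := h37.toProp36Hypotheses
  have hcoh : 𝒢.IsCoherent := hsc.isCoherent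
  have h37S : S.coveringGraph.Thm37Hypotheses := S.thm37Hypotheses_coveringGraph h37 hsc hS hSc
  have hEDS : EdgeLikeDistinctAt S.coveringGraph := S.edgeLikeDistinctAt_coveringGraph h37 hcoh hCV hS hSc
  have hVI := verticialInjective_holds.{u}
  -- notation-free abbreviations
  let U : Subgroup c.G := BTemp.stab (c.equiv.functor.obj ⟨S, hS⟩) (Quot.out ω₀)
  let tr : Subgroup c.G → Subgroup cS.G := fun K => (K.subgroupOf U).map φ.toMonoidHom
  -- vertices: Part-A facts
  have hV1 : ∀ (v : 𝒢.graph.Vertex) (ω : BTemp.Orbits (S.SV v)), ∃ K ∈ verticialSubgroups c v,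
      tr K ∈ verticialSubgroups cS (⟨v, ω⟩ : S.coveringGraph.graph.Vertex) := fun v ω =>
    S.exists_trace_mem_verticialSubgroups h36 hcoh c hS hSc cS ω₀ φ hφ v ω
  have hVsame : ∀ {v : 𝒢.graph.Vertex} {ω : BTemp.Orbits (S.SV v)} {K : Subgroup c.G} (n : c.G), n ∈ U →
      tr K ∈ verticialSubgroups cS (⟨v, ω⟩ : S.coveringGraph.graph.Vertex) →
      tr (K.map (MulAut.conj n).toMonoidHom) ∈ verticialSubgroups cS (⟨v, ω⟩ : S.coveringGraph.graph.Vertex) :=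
    fun {v ω K} n hn h => S.traces_same_vertex_of_mem_stab c hS cS ω₀ φ h ⟨n, hn⟩
  have hVconj : ∀ {v : 𝒢.graph.Vertex} {ω : BTemp.Orbits (S.SV v)} {K K' : Subgroup c.G},
      K ∈ verticialSubgroups c v → K' ∈ verticialSubgroups c v →
      tr K ∈ verticialSubgroups cS (⟨v, ω⟩ : S.coveringGraph.graph.Vertex) →
      tr K' ∈ verticialSubgroups cS (⟨v, ω⟩ : S.coveringGraph.graph.Vertex) →
      ∃ n ∈ U, K' = K.map (MulAut.conj n).toMonoidHom := fun {v ω K K'} hK hK' h h' => by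
    obtain ⟨u, hu⟩ := S.exists_mem_stab_conj_eq_of_traces_same_vertex c hS cS ω₀ φ h37 hφb hK hK' h h'
    exact ⟨(u : c.G), u.2, hu⟩
  have hVuniq : ∀ (v : 𝒢.graph.Vertex) {K : Subgroup c.G}, K ∈ verticialSubgroups c v →
      ∃! ω : BTemp.Orbits (S.SV v), tr K ∈ verticialSubgroups cS (⟨v, ω⟩ : S.coveringGraph.graph.Vertex) :=
    fun v K hK => S.existsUnique_orbit_trace_mem_verticialSubgroups h36 hcoh c hS hSc cS ω₀ φ hφ h37 hsc v hK
  have hVdist : ∀ {v : 𝒢.graph.Vertex} {ω ω' : BTemp.Orbits (S.SV v)} {H : Subgroup cS.G},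
      H ∈ verticialSubgroups cS (⟨v, ω⟩ : S.coveringGraph.graph.Vertex) →
      H ∈ verticialSubgroups cS (⟨v, ω'⟩ : S.coveringGraph.graph.Vertex) → ω = ω' := fun {v ω ω' H} h h' => by
    by_contra hne
    have h0 := (verticialDistinct_holds _ h37S cS).1 _ _ _ _ h h' (fun heq => hne (eq_of_heq (Sigma.mk.inj heq).2))
    rw [Subgroup.relIndex_self] at h0
    exact one_ne_zero h0
  -- edges: Part-D facts
  have hE1 : ∀ (e : 𝒢.graph.Edge) (ω : BTemp.Orbits (S.SE e)), ∃ L ∈ edgeLikeSubgroups c e,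
      tr L ∈ edgeLikeSubgroups cS (⟨e, ω⟩ : S.coveringGraph.graph.Edge) := fun e ω =>
    S.exists_traceE_mem_edgeLikeSubgroups h36 hcoh c hS hSc cS ω₀ φ hφ e ω
  have hEsame : ∀ {e : 𝒢.graph.Edge} {ω : BTemp.Orbits (S.SE e)} {L : Subgroup c.G} (n : c.G), n ∈ U →
      tr L ∈ edgeLikeSubgroups cS (⟨e, ω⟩ : S.coveringGraph.graph.Edge) →
      tr (L.map (MulAut.conj n).toMonoidHom) ∈ edgeLikeSubgroups cS (⟨e, ω⟩ : S.coveringGraph.graph.Edge) :=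
    fun {e ω L} n hn h => S.tracesE_same_edge_of_mem_stab c hS cS ω₀ φ h ⟨n, hn⟩
  have hEconj : ∀ {e : 𝒢.graph.Edge} {ω : BTemp.Orbits (S.SE e)} {L L' : Subgroup c.G},
      L ∈ edgeLikeSubgroups c e → L' ∈ edgeLikeSubgroups c e →
      tr L ∈ edgeLikeSubgroups cS (⟨e, ω⟩ : S.coveringGraph.graph.Edge) →
      tr L' ∈ edgeLikeSubgroups cS (⟨e, ω⟩ : S.coveringGraph.graph.Edge) →
      ∃ n ∈ U, L' = L.map (MulAut.conj n).toMonoidHom := fun {e ω L L'} hL hL' h h' => by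
    obtain ⟨u, hu⟩ := S.exists_mem_stab_conj_eq_of_tracesE_same_edge c hS cS ω₀ φ hφb
      (fun hL hL' hc => hCT e _ _ hL hL' hc) hL hL' h h'
    exact ⟨(u : c.G), u.2, hu⟩
  have hEuniq : ∀ (e : 𝒢.graph.Edge) {L : Subgroup c.G}, L ∈ edgeLikeSubgroups c e →
      ∃! ω : BTemp.Orbits (S.SE e), tr L ∈ edgeLikeSubgroups cS (⟨e, ω⟩ : S.coveringGraph.graph.Edge) :=
    fun e L hL => S.existsUnique_orbit_traceE_mem_edgeLikeSubgroups h36 hcoh c hS cS ω₀ φ hφ h37S hEDS e hL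
  -- the vertex actions, fibre by fibre
  let specV : ∀ v : 𝒢.graph.Vertex, c.G → BTemp.Orbits (S.SV v) → BTemp.Orbits (S.SV v) → Prop :=
    fun v g ω ω' => ∀ K ∈ verticialSubgroups c v,
      tr K ∈ verticialSubgroups cS (⟨v, ω⟩ : S.coveringGraph.graph.Vertex) →
      tr (K.map (MulAut.conj g).toMonoidHom) ∈ verticialSubgroups cS (⟨v, ω'⟩ : S.coveringGraph.graph.Vertex)
  have hVex : ∀ v g ω, ∃! ω', specV v g ω ω' := by
    intro v g ω
    obtain ⟨K₁, hK₁, h₁⟩ := hV1 v ω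
    have hgK₁ : K₁.map (MulAut.conj g).toMonoidHom ∈ verticialSubgroups c v := conj_mem_verticialSubgroups c hK₁ g
    obtain ⟨ω₂, hω₂, -⟩ := hVuniq v hgK₁
    refine ⟨ω₂, fun K hK hKx => ?_, fun ω' hall => hVdist (hall K₁ hK₁ h₁) hω₂⟩
    obtain ⟨n, hn, rfl⟩ := hVconj hK₁ hK h₁ hKx
    rw [map_conj_conj_swap' K₁ g n]
    exact hVsame (g * n * g⁻¹) (hU.conj_mem n hn g) hω₂
  have hσ' : ∀ v, ∃ σv : c.G →* Equiv.Perm (BTemp.Orbits (S.SV v)), ∀ g ω, specV v g ω (σv g ω) := fun v =>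
    exists_perm_hom_of_existsUnique' (specV v) (hVex v)
      (fun ω K _ hKx => by rw [map_conj_one'']; exact hKx)
      (fun g h ω ω' ω'' hy hz K hK hKx => by
        rw [map_conj_mul'']
        exact hz _ (conj_mem_verticialSubgroups c hK h) (hy K hK hKx))
  choose σ hσ using hσ'
  -- the edge actions, fibre by fibre
  have hEdist : ∀ {e : 𝒢.graph.Edge} {ω ω' : BTemp.Orbits (S.SE e)} {H : Subgroup cS.G},
      H ∈ edgeLikeSubgroups cS (⟨e, ω⟩ : S.coveringGraph.graph.Edge) →
      H ∈ edgeLikeSubgroups cS (⟨e, ω'⟩ : S.coveringGraph.graph.Edge) → ω = ω' := fun {e ω ω' H} h h' => by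
    by_contra hne
    have h0 := hEDS h37S cS _ _ _ _ h h' (fun heq => hne (eq_of_heq (Sigma.mk.inj heq).2))
    rw [Subgroup.relIndex_self] at h0
    exact one_ne_zero h0
  let specE : ∀ e : 𝒢.graph.Edge, c.G → BTemp.Orbits (S.SE e) → BTemp.Orbits (S.SE e) → Prop :=
    fun e g ω ω' => ∀ L ∈ edgeLikeSubgroups c e,
      tr L ∈ edgeLikeSubgroups cS (⟨e, ω⟩ : S.coveringGraph.graph.Edge) →
      tr (L.map (MulAut.conj g).toMonoidHom) ∈ edgeLikeSubgroups cS (⟨e, ω'⟩ : S.coveringGraph.graph.Edge)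
  have hEex : ∀ e g ω, ∃! ω', specE e g ω ω' := by
    intro e g ω
    obtain ⟨L₁, hL₁, h₁⟩ := hE1 e ω
    have hgL₁ : L₁.map (MulAut.conj g).toMonoidHom ∈ edgeLikeSubgroups c e := conj_mem_edgeLikeSubgroups' c hL₁ g
    obtain ⟨ω₂, hω₂, -⟩ := hEuniq e hgL₁
    refine ⟨ω₂, fun L hL hLy => ?_, fun ω' hall => hEdist (hall L₁ hL₁ h₁) hω₂⟩
    obtain ⟨n, hn, rfl⟩ := hEconj hL₁ hL h₁ hLy
    rw [map_conj_conj_swap' L₁ g n]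
    exact hEsame (g * n * g⁻¹) (hU.conj_mem n hn g) hω₂
  have hτ' : ∀ e, ∃ τe : c.G →* Equiv.Perm (BTemp.Orbits (S.SE e)), ∀ g ω, specE e g ω (τe g ω) := fun e =>
    exists_perm_hom_of_existsUnique' (specE e) (hEex e)
      (fun ω L _ hLy => by rw [map_conj_one'']; exact hLy)
      (fun g h ω ω' ω'' hy hz L hL hLy => by
        rw [map_conj_mul'']
        exact hz _ (conj_mem_edgeLikeSubgroups' c hL h) (hy L hL hLy))
  choose τ hτ using hτ'
  refine ⟨σ, τ, fun g v ω K hK hKx => hσ v g ω K hK hKx, ?_, ?_, fun g e ω L hL hLy => hτ e g ω L hL hLy, ?_, ?_, ?_⟩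
  · -- vertices: transitivity
    intro v ω₁ ω₂
    obtain ⟨K₁, hK₁, h₁⟩ := hV1 v ω₁
    obtain ⟨K₂, hK₂, h₂⟩ := hV1 v ω₂
    obtain ⟨γ, rfl⟩ := exists_conj_of_mem_verticialSubgroups c hK₁ hK₂
    refine ⟨γ, (hVex v γ ω₁).unique (hσ v γ _) fun K hK hKx => ?_⟩
    obtain ⟨n, hn, rfl⟩ := hVconj hK₁ hK h₁ hKx
    rw [map_conj_conj_swap' K₁ γ n]
    exact hVsame (γ * n * γ⁻¹) (hU.conj_mem n hn γ) h₂
  · -- vertices: `U` acts trivially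
    intro v n hn
    exact Equiv.ext fun ω => (hVex v n ω).unique (hσ v n _) fun K _ hKx => hVsame n hn hKx
  · -- edges: transitivity
    intro e ω₁ ω₂
    obtain ⟨L₁, hL₁, h₁⟩ := hE1 e ω₁
    obtain ⟨L₂, hL₂, h₂⟩ := hE1 e ω₂
    obtain ⟨γ, rfl⟩ := exists_conj_of_mem_edgeLikeSubgroups c hL₁ hL₂
    refine ⟨γ, (hEex e γ ω₁).unique (hτ e γ _) fun L hL hLy => ?_⟩
    obtain ⟨n, hn, rfl⟩ := hEconj hL₁ hL h₁ hLy
    rw [map_conj_conj_swap' L₁ γ n]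
    exact hEsame (γ * n * γ⁻¹) (hU.conj_mem n hn γ) h₂
  · -- edges: `U` acts trivially
    intro e n hn
    exact Equiv.ext fun ω => (hEex e n ω).unique (hτ e n _) fun L _ hLy => hEsame n hn hLy
  · -- INCIDENCE
    intro g b v hb ω
    -- the incidence dictionary at `(b, ω)`: host `K = χ(Π_v)` through `b` of `L = χ(g₀) χ(Π_b) χ(g₀)⁻¹`
    obtain ⟨χ, g₀, hχv, hKx, hLy⟩ := S.exists_branch_traces_of_abuts h36 hcoh c hS hSc cS ω₀ φ hφ hb ω
    obtain ⟨hK, hL⟩ := range_mem_and_map_branchSubgroup_conj_mem hb χ hχv g₀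
    -- where `g` takes them
    have hgK := hσ v g _ _ hK hKx
    have hgL := hτ _ g ω _ hL hLy
    -- the incidence dictionary at `(b, τ g ω)`
    obtain ⟨χ₂, g₂, hχ₂v, hK₂x, hL₂y⟩ :=
      S.exists_branch_traces_of_abuts h36 hcoh c hS hSc cS ω₀ φ hφ hb (τ (𝒢.graph.edgeOf b) g ω)
    obtain ⟨hK₂, hL₂⟩ := range_mem_and_map_branchSubgroup_conj_mem hb χ₂ hχ₂v g₂
    -- the two edge-like subgroups traced at `(e, τ g ω)` are `U`-conjugate
    obtain ⟨n, hn, hL₂eq⟩ := hEconj (conj_mem_edgeLikeSubgroups' c hL g) hL₂ hgL hL₂y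
    -- rewrite the `χ₂`-presentation through `χ` (verticial homomorphisms at `v` are conjugate)
    obtain ⟨iχ⟩ := hχv
    obtain ⟨iχ₂⟩ := hχ₂v
    obtain ⟨y, hy, -⟩ := BTemp.exists_conj_of_natTrans c.isTempered χ χ₂ (iχ.symm ≪≫ iχ₂).hom
    have hK₂eq : χ₂.toMonoidHom.range = χ.toMonoidHom.range.map (MulAut.conj (χ₂ g₂ * y)).toMonoidHom := by
      rw [map_conj_mul'', ← range_eq_map_conj_of_conj_eq c χ χ₂ y hy,
        map_conj_eq_self_of_mem'' (K := χ₂.toMonoidHom.range) (g := χ₂ g₂) ⟨g₂, rfl⟩]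
    have hL₂χ : ((𝒢.branchSubgroup b v hb).map χ₂.toMonoidHom).map (MulAut.conj (χ₂ g₂)).toMonoidHom =
        ((𝒢.branchSubgroup b v hb).map χ.toMonoidHom).map (MulAut.conj (χ₂ g₂ * y)).toMonoidHom :=
      map_map_conj_eq_of_conj_eq' χ χ₂ y hy _ _
    -- the same edge-like subgroup presented through `b` twice ⇒ the hosts through `b` coincide
    have hpres : ((𝒢.branchSubgroup b v hb).map χ.toMonoidHom).map (MulAut.conj (χ₂ g₂ * y)).toMonoidHom =
        ((𝒢.branchSubgroup b v hb).map χ.toMonoidHom).map (MulAut.conj (n * g * χ g₀)).toMonoidHom := by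
      rw [← hL₂χ, hL₂eq, map_conj_mul'', map_conj_mul'']
    have hhost := host_eq_of_presentations_through_branch' hCV h37 c hb χ ⟨iχ⟩ _ _ hpres
    -- so `K₂ = n (g K g⁻¹) n⁻¹`, and the trace of `g K g⁻¹` is verticial at `(v, glueOrbit (τ g ω))`
    have hK₂eq' : χ₂.toMonoidHom.range =
        ((χ.toMonoidHom.range.map (MulAut.conj g).toMonoidHom).map (MulAut.conj n).toMonoidHom) := by
      rw [hK₂eq, hhost, map_conj_mul'', map_conj_mul'',
        map_conj_eq_self_of_mem'' (K := χ.toMonoidHom.range) (g := χ g₀) ⟨g₀, rfl⟩]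
    have hgK' : tr (χ.toMonoidHom.range.map (MulAut.conj g).toMonoidHom) ∈
        verticialSubgroups cS (⟨v, S.glueOrbit b v hb (τ (𝒢.graph.edgeOf b) g ω)⟩ : S.coveringGraph.graph.Vertex) := by
      have h := hVsame n⁻¹ (U.inv_mem hn) (hK₂eq' ▸ hK₂x)
      rwa [← map_conj_mul'', inv_mul_cancel, map_conj_one''] at h
    exact hVdist hgK hgK'

end CovObj

end ProfiniteSemiGraph

end Literature.AnabelianGeometry.SemiGraphs

end
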